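import Literature.MathematicalPhysics.KineticTheory.RiemannLocalGibbsConsistency
import Mathlib.MeasureTheory.Integral.Layercake
import HarnessLib

/-!
# Local limits of the free finite-volume hard-sphere distributions

Topic `Literature/MathematicalPhysics/KineticTheory`; PROOFS (no definitions, no named facts),
fifth file towards the discharge of
`Literature.MathematicalPhysics.KineticTheory.RiemannLocalGibbsExistsUnique`
(`RiemannLocalGibbsLaw.lean`): the thermodynamic limit of the free distributions
`γ_{B(0,n)}(· | ∅)` seen in a fixed window `B(0,k) × ℝ³`.

* `lintegral_le_lintegral_add_of_measure_le` — integrals of `[0,1]`-valued functions against two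
  setwise-close measures are close (layer cake);
* `exists_measure_of_uniformly_cauchy` — a sequence of probability measures that is UNIFORMLY
  Cauchy on measurable sets has a setwise limit, a probability measure (σ-additivity of the limit
  set function: its tails are dominated by those of one of the measures; a "Vitali–Hahn–Saks"
  in the easy uniform case);
* `exists_limit_marginals` — at small activity (`2κ < 1`) the laws of the configuration in
  `B(0,k) × ℝ³` under `γ_{B(0,n)}(· | ∅)` are uniformly Cauchy in `n` (consistency + decay of the
  boundary influence), and their limits `π_k` form a CONSISTENT family of probability measures,
  dominated by `e^{ν(B(0,k) × ℝ³)} P_{B(0,k)}`, carried by hard-core configurations inside the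
  window, and satisfying the finite-window DLR identities
  `∫ γ_Λ(ξ'|_{B(0,k)} ∈ A' | ξ) π_k(dξ) = π_k(A')` for regions `Λ` whose `σ`-neighbourhood lies in
  `B(0,k)` (the limit of the consistency identities).

## References

* H.-O. Georgii, *Gibbs Measures and Phase Transitions* (2011), §4.4 (existence via local
  convergence). [Georgii2011]
* M. Michelen, W. Perkins, arXiv:2109.01094, §5. [MichelenPerkins2021]
-/

noncomputable section

open MeasureTheory ProbabilityTheory Set Filter
open scoped ENNReal NNReal Topology

namespace Literature.MathematicalPhysics.KineticTheory

open Literature.Analysis.FunctionSpaces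
open Literature.MathematicalPhysics.StatisticalMechanics
open Literature.MathematicalPhysics.StatisticalMechanics.HardSphere (Pos Phase window hardCoreSet
  glue poissonLaw IsHardCore)

/-! ### Integrals against setwise-close measures -/

section Layercake

variable {α : Type*} [MeasurableSpace α]

/-- **Integrals of `[0,1]`-valued functions against setwise-close measures are close**: if
`Q(A) ≤ π(A) + δ` for every measurable `A`, then `∫ f dQ ≤ ∫ f dπ + δ` for measurable
`0 ≤ f ≤ 1` (layer cake: `∫ f dQ = ∫₀¹ Q{f ≥ t} dt`). [folklore] -/
theorem lintegral_le_lintegral_add_of_measure_le {Q π : Measure α} [IsFiniteMeasure Q]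
    [IsFiniteMeasure π] {δ : ℝ≥0∞} (h : ∀ A : Set α, MeasurableSet A → Q A ≤ π A + δ)
    {f : α → ℝ} (hf : Measurable f) (hf0 : ∀ x, 0 ≤ f x) (hf1 : ∀ x, f x ≤ 1) :
    ∫⁻ x, ENNReal.ofReal (f x) ∂Q ≤ ∫⁻ x, ENNReal.ofReal (f x) ∂π + δ := by
  have hmeas : ∀ t : ℝ, MeasurableSet {a : α | t ≤ f a} := fun t =>
    measurableSet_le measurable_const hf
  have hempty : ∀ (μ : Measure α), ∀ t ∈ Ioi (1 : ℝ), μ {a : α | t ≤ f a} = 0 := by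
    intro μ t ht
    have : {a : α | t ≤ f a} = ∅ := eq_empty_of_forall_notMem fun a ha =>
      absurd (lt_of_lt_of_le (mem_Ioi.1 ht) ha) (not_lt.2 (hf1 a))
    rw [this, measure_empty]
  have hsplit : ∀ (μ : Measure α), ∫⁻ t in Ioi 0, μ {a : α | t ≤ f a} =
      ∫⁻ t in Ioc 0 1, μ {a : α | t ≤ f a} := by
    intro μ
    rw [← Ioc_union_Ioi_eq_Ioi zero_le_one, lintegral_union measurableSet_Ioi
      (Ioc_disjoint_Ioi le_rfl), setLIntegral_eq_zero measurableSet_Ioi (fun t ht => hempty μ t ht),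
      add_zero]
  rw [lintegral_eq_lintegral_meas_le Q (Eventually.of_forall hf0) hf.aemeasurable,
    lintegral_eq_lintegral_meas_le π (Eventually.of_forall hf0) hf.aemeasurable, hsplit, hsplit]
  calc ∫⁻ t in Ioc 0 1, Q {a : α | t ≤ f a}
      ≤ ∫⁻ t in Ioc 0 1, (π {a : α | t ≤ f a} + δ) := lintegral_mono fun t => h _ (hmeas t)
    _ = (∫⁻ t in Ioc 0 1, π {a : α | t ≤ f a}) + δ * volume (Ioc (0 : ℝ) 1) := by
        rw [lintegral_add_right _ measurable_const, setLIntegral_const]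
    _ = (∫⁻ t in Ioc 0 1, π {a : α | t ≤ f a}) + δ := by
        rw [Real.volume_Ioc, sub_zero, ENNReal.ofReal_one, mul_one]

/-- Real form: if `|Q(A) - π(A)| ≤ δ` on measurable sets (finite measures), then
`|∫ f dQ - ∫ f dπ| ≤ δ` for measurable `0 ≤ f ≤ 1`. [folklore] -/
theorem abs_lintegral_toReal_sub_le_of_abs_measureReal_sub_le {Q π : Measure α} [IsFiniteMeasure Q]
    [IsFiniteMeasure π] {δ : ℝ} (h : ∀ A : Set α, MeasurableSet A → |Q.real A - π.real A| ≤ δ)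
    {f : α → ℝ} (hf : Measurable f) (hf0 : ∀ x, 0 ≤ f x) (hf1 : ∀ x, f x ≤ 1) :
    |(∫⁻ x, ENNReal.ofReal (f x) ∂Q).toReal - (∫⁻ x, ENNReal.ofReal (f x) ∂π).toReal| ≤ δ := by
  have hδ : 0 ≤ δ := le_trans (abs_nonneg _) (h ∅ MeasurableSet.empty)
  have hfin : ∀ (μ : Measure α) [IsFiniteMeasure μ], ∫⁻ x, ENNReal.ofReal (f x) ∂μ ≠ ∞ := by
    intro μ _
    refine ne_top_of_le_ne_top (measure_ne_top μ univ) ?_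
    calc ∫⁻ x, ENNReal.ofReal (f x) ∂μ ≤ ∫⁻ _, 1 ∂μ :=
          lintegral_mono fun x => ENNReal.ofReal_le_one.2 (hf1 x)
      _ = μ univ := lintegral_one
  have h1 : ∀ A : Set α, MeasurableSet A → Q A ≤ π A + ENNReal.ofReal δ := fun A hA => by
    have := (abs_sub_le_iff.1 (h A hA)).1
    rw [← ENNReal.ofReal_toReal (measure_ne_top Q A), ← ENNReal.ofReal_toReal (measure_ne_top π A),
      ← ENNReal.ofReal_add ENNReal.toReal_nonneg hδ]
    exact ENNReal.ofReal_le_ofReal (by rw [measureReal_def, measureReal_def] at this; linarith)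
  have h2 : ∀ A : Set α, MeasurableSet A → π A ≤ Q A + ENNReal.ofReal δ := fun A hA => by
    have := (abs_sub_le_iff.1 (h A hA)).2
    rw [← ENNReal.ofReal_toReal (measure_ne_top Q A), ← ENNReal.ofReal_toReal (measure_ne_top π A),
      ← ENNReal.ofReal_add ENNReal.toReal_nonneg hδ]
    exact ENNReal.ofReal_le_ofReal (by rw [measureReal_def, measureReal_def] at this; linarith)
  have hQπ := lintegral_le_lintegral_add_of_measure_le h1 hf hf0 hf1
  have hπQ := lintegral_le_lintegral_add_of_measure_le h2 hf hf0 hf1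
  rw [abs_sub_le_iff]
  constructor
  · have := ENNReal.toReal_mono (ENNReal.add_ne_top.2 ⟨hfin π, ENNReal.ofReal_ne_top⟩) hQπ
    rw [ENNReal.toReal_add (hfin π) ENNReal.ofReal_ne_top, ENNReal.toReal_ofReal hδ] at this
    linarith
  · have := ENNReal.toReal_mono (ENNReal.add_ne_top.2 ⟨hfin Q, ENNReal.ofReal_ne_top⟩) hπQ
    rw [ENNReal.toReal_add (hfin Q) ENNReal.ofReal_ne_top, ENNReal.toReal_ofReal hδ] at this
    linarith

end Layercake

/-! ### Setwise limits of uniformly Cauchy sequences of probability measures -/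

section SetwiseLimit

variable {α : Type*} [MeasurableSpace α]

/-- **A uniformly Cauchy sequence of probability measures converges setwise to a probability
measure**: if for every `ε > 0` eventually `|Qₙ(A) - Qₙ'(A)| ≤ ε` for ALL measurable `A`
simultaneously, then there is a probability measure `P` with `|Qₙ(A) - P(A)| ≤ ε` eventually,
uniformly in `A`.  The limit set function is finitely additive as a pointwise limit; it is
σ-additive because its tail on a disjoint union, `P(⋃_{i ≥ I} Aᵢ) ≤ Q_N(⋃_{i ≥ I} Aᵢ) + ε`, is
dominated by the tail of the single measure `Q_N`. [folklore] -/
theorem exists_measure_of_uniformly_cauchy (Q : ℕ → Measure α) [∀ n, IsProbabilityMeasure (Q n)]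
    (h : ∀ ε > 0, ∃ N, ∀ n ≥ N, ∀ n' ≥ N, ∀ A : Set α, MeasurableSet A →
      |(Q n).real A - (Q n').real A| ≤ ε) :
    ∃ P : Measure α, IsProbabilityMeasure P ∧
      ∀ ε > 0, ∃ N, ∀ n ≥ N, ∀ A : Set α, MeasurableSet A → |(Q n).real A - P.real A| ≤ ε := by
  classical
  -- pointwise limits
  have hconv : ∀ A : Set α, MeasurableSet A → ∃ a : ℝ, Tendsto (fun n => (Q n).real A) atTop (𝓝 a) := by
    intro A hA
    refine cauchySeq_tendsto_of_complete (Metric.cauchySeq_iff.2 fun ε hε => ?_)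
    obtain ⟨N, hN⟩ := h (ε / 2) (half_pos hε)
    exact ⟨N, fun m hm n hn => by
      rw [Real.dist_eq]; exact lt_of_le_of_lt (hN m hm n hn A hA) (half_lt_self hε)⟩
  set m : Set α → ℝ := fun A => if hA : MeasurableSet A then (hconv A hA).choose else 0 with hm
  have hlim : ∀ {A : Set α}, MeasurableSet A → Tendsto (fun n => (Q n).real A) atTop (𝓝 (m A)) := by
    intro A hA
    simp only [hm, dif_pos hA]
    exact (hconv A hA).choose_spec
  -- uniform closeness of the limit
  have hclose : ∀ ε > 0, ∃ N, ∀ n ≥ N, ∀ A : Set α, MeasurableSet A → |(Q n).real A - m A| ≤ ε := by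
    intro ε hε
    obtain ⟨N, hN⟩ := h ε hε
    refine ⟨N, fun n hn A hA => ?_⟩
    refine le_of_tendsto ((tendsto_const_nhds.sub (hlim hA)).abs) ?_
    exact eventually_atTop.2 ⟨N, fun n' hn' => hN n hn n' hn' A hA⟩
  -- elementary properties of the limit set function
  have hm0 : ∀ {A : Set α}, MeasurableSet A → 0 ≤ m A := fun hA =>
    ge_of_tendsto' (hlim hA) fun n => measureReal_nonneg
  have hm_empty : m ∅ = 0 :=
    tendsto_nhds_unique (hlim MeasurableSet.empty) (by simp)
  have hm_univ : m univ = 1 :=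
    tendsto_nhds_unique (hlim MeasurableSet.univ) (by simp)
  have hm_union : ∀ {A B : Set α}, MeasurableSet A → MeasurableSet B → Disjoint A B →
      m (A ∪ B) = m A + m B := by
    intro A B hA hB hAB
    refine tendsto_nhds_unique (hlim (hA.union hB)) ?_
    have : (fun n => (Q n).real (A ∪ B)) = fun n => (Q n).real A + (Q n).real B := by
      funext n; exact measureReal_union hAB hB
    rw [this]
    exact (hlim hA).add (hlim hB)
  have hm_biUnion : ∀ {f : ℕ → Set α}, (∀ i, MeasurableSet (f i)) → Pairwise (Function.onFun Disjoint f) →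
      ∀ I : ℕ, m (⋃ i ∈ Finset.range I, f i) = ∑ i ∈ Finset.range I, m (f i) := by
    intro f hf hd I
    induction I with
    | zero => simp [hm_empty]
    | succ I ih =>
      rw [Finset.range_add_one, Finset.sum_insert Finset.notMem_range_self,
        Finset.set_biUnion_insert, hm_union (hf I) (Finset.measurableSet_biUnion _ fun i _ => hf i) ?_,
        ih]
      rw [Set.disjoint_iUnion₂_right]
      intro i hi
      exact hd (Finset.mem_range.1 hi).ne'
  -- σ-additivity
  have hm_iUnion : ∀ {f : ℕ → Set α}, (∀ i, MeasurableSet (f i)) → Pairwise (Function.onFun Disjoint f) →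
      HasSum (fun i => m (f i)) (m (⋃ i, f i)) := by
    intro f hf hd
    have hU : MeasurableSet (⋃ i, f i) := MeasurableSet.iUnion hf
    set T : ℕ → Set α := fun I => (⋃ i, f i) \ ⋃ i ∈ Finset.range I, f i with hT
    have hTm : ∀ I, MeasurableSet (T I) := fun I =>
      hU.diff (Finset.measurableSet_biUnion _ fun i _ => hf i)
    have hTanti : Antitone T := by
      intro I J hIJ x hx
      refine ⟨hx.1, fun hx' => hx.2 ?_⟩
      obtain ⟨i, hi, hxi⟩ := mem_iUnion₂.1 hx'
      exact mem_iUnion₂.2 ⟨i, Finset.mem_range.2 (lt_of_lt_of_le (Finset.mem_range.1 hi) hIJ), hxi⟩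
    have hTinter : ⋂ I, T I = ∅ := by
      refine eq_empty_of_forall_notMem fun x hx => ?_
      rw [mem_iInter] at hx
      obtain ⟨i, hxi⟩ := mem_iUnion.1 (hx 0).1
      exact (hx (i + 1)).2 (mem_iUnion₂.2 ⟨i, Finset.mem_range.2 (Nat.lt_succ_self i), hxi⟩)
    -- decomposition `m(⋃ f) = ∑_{i<I} m(f i) + m(T I)`
    have hdec : ∀ I, m (⋃ i, f i) = ∑ i ∈ Finset.range I, m (f i) + m (T I) := by
      intro I
      rw [← hm_biUnion hf hd I, ← hm_union (Finset.measurableSet_biUnion _ fun i _ => hf i) (hTm I)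
        disjoint_sdiff_right]
      congr 1
      rw [hT, union_sdiff_cancel]
      exact iUnion₂_subset fun i _ => subset_iUnion f i
    -- the tail tends to zero
    have htail : Tendsto (fun I => m (T I)) atTop (𝓝 0) := by
      rw [Metric.tendsto_atTop]
      intro ε hε
      obtain ⟨N, hN⟩ := hclose (ε / 2) (half_pos hε)
      have hQN : Tendsto (fun I => (Q N).real (T I)) atTop (𝓝 0) := by
        have h1 := tendsto_measure_iInter_atTop (μ := Q N) (fun I => (hTm I).nullMeasurableSet) hTanti
          ⟨0, measure_ne_top _ _⟩
        rw [hTinter, measure_empty] at h1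
        have h2 := (ENNReal.tendsto_toReal ENNReal.zero_ne_top).comp h1
        rw [ENNReal.toReal_zero] at h2
        exact h2
      rw [Metric.tendsto_atTop] at hQN
      obtain ⟨I₀, hI₀⟩ := hQN (ε / 2) (half_pos hε)
      refine ⟨I₀, fun I hI => ?_⟩
      have h3 := hI₀ I hI
      rw [Real.dist_eq, sub_zero] at h3 ⊢
      have h4 := hN N le_rfl (T I) (hTm I)
      rw [abs_of_nonneg (hm0 (hTm I))]
      rw [abs_of_nonneg measureReal_nonneg] at h3
      have := (abs_sub_le_iff.1 h4).2
      change (Q N).real (T I) < ε / 2 at h3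
      linarith
    rw [hasSum_iff_tendsto_nat_of_nonneg (fun i => hm0 (hf i))]
    have : (fun I => ∑ i ∈ Finset.range I, m (f i)) = fun I => m (⋃ i, f i) - m (T I) := by
      funext I; rw [hdec I]; ring
    rw [this]
    simpa using (tendsto_const_nhds (x := m (⋃ i, f i))).sub htail
  -- the measure
  refine ⟨Measure.ofMeasurable (fun A _ => ENNReal.ofReal (m A)) (by simp [hm_empty])
    (fun f hf hd => ?_), ⟨?_⟩, fun ε hε => ?_⟩
  · rw [(hm_iUnion hf hd).tsum_eq.symm, ENNReal.ofReal_tsum_of_nonneg (fun i => hm0 (hf i))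
      (hm_iUnion hf hd).summable]
  · rw [Measure.ofMeasurable_apply _ MeasurableSet.univ, hm_univ, ENNReal.ofReal_one]
  · obtain ⟨N, hN⟩ := hclose ε hε
    refine ⟨N, fun n hn A hA => ?_⟩
    have hP : (Measure.ofMeasurable (fun A _ => ENNReal.ofReal (m A)) (by simp [hm_empty])
        (fun f hf hd => by
          rw [(hm_iUnion hf hd).tsum_eq.symm, ENNReal.ofReal_tsum_of_nonneg (fun i => hm0 (hf i))
            (hm_iUnion hf hd).summable]) : Measure α).real A = m A := by
      rw [measureReal_def, Measure.ofMeasurable_apply _ hA, ENNReal.toReal_ofReal (hm0 hA)]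
    rw [hP]
    exact hN n hn A hA

end SetwiseLimit

/-! ### Locality of the specification in the boundary condition -/

section Locality

variable (ν : Measure Phase) {σ : ℝ}

/-- Restricting a glued configuration to a window containing the `σ`-neighbourhood of `Λ` does
not see the part of the boundary condition outside that window. [folklore] -/
theorem restrict_glue_restrict (Λ : Set Pos) (s : Set Phase) (ζ ξ : PointConfig Phase) :
    (glue Λ (ζ.restrict s) ξ).restrict s = (glue Λ ζ ξ).restrict s := by
  refine PointConfig.ext fun x => ?_
  simp only [glue, mem_restrict_iff, PointConfig.mem_union, mem_compl_iff]
  tauto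

/-- **Locality**: for a hard-core boundary condition `ζ` and a region `Λ` whose `σ`-neighbourhood
lies in `B(0,k)`, the distribution `γ_Λ(· | ζ)` of the configuration in `B(0,k) × ℝ³` only depends
on `ζ|_{B(0,k) × ℝ³}` (particles of `ζ` outside `B(0,k)` are farther than `σ` from `Λ`).
[cite: Georgii2011, Def. 1.23] -/
theorem hsLocalSpec_restrict_boundary_apply {Λ : Set Pos} (hΛ : MeasurableSet Λ) {k : ℝ}
    (hΛσ : ∀ q ∈ Λ, ∀ p : Pos, dist p q < σ → p ∈ Metric.ball (0 : Pos) k)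
    {ζ : PointConfig Phase} (hζ : IsHardCore σ ζ) {A' : Set (PointConfig Phase)}
    (hA' : MeasurableSet A') :
    hsLocalSpec σ ν Λ (ζ.restrict (window (Metric.ball (0 : Pos) k)))
        (PointConfig.restrict (window (Metric.ball (0 : Pos) k)) ⁻¹' A') =
      hsLocalSpec σ ν Λ ζ (PointConfig.restrict (window (Metric.ball (0 : Pos) k)) ⁻¹' A') := by
  set W := window (Metric.ball (0 : Pos) k) with hW
  have hWm : MeasurableSet W := HardSphere.measurableSet_window Metric.isOpen_ball.measurableSet
  have hB : MeasurableSet (PointConfig.restrict W ⁻¹' A' : Set (PointConfig Phase)) :=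
    hA'.preimage (PointConfig.measurable_restrict hWm)
  -- the hard-core events agree
  have hHC : ∀ ξ : PointConfig Phase, IsHardCore σ (glue Λ (ζ.restrict W) ξ) ↔ IsHardCore σ (glue Λ ζ ξ) := by
    intro ξ
    constructor
    · intro h
      rw [glue, isHardCore_union_iff]
      refine ⟨h.of_subset fun x hx => Or.inl hx, hζ.restrict _, fun x hx y hy hxy => ?_⟩
      by_cases hyW : y ∈ W
      · exact h x (Or.inl hx) y (Or.inr ⟨⟨hy.1, hyW⟩, hy.2⟩) hxy
      · by_contra hlt
        rw [not_le] at hlt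
        have hxΛ : x.1 ∈ Λ := by
          have := hx.2; rwa [HardSphere.mem_window] at this
        have := hΛσ x.1 hxΛ y.1 (by rwa [dist_comm] at hlt)
        exact hyW (by rw [hW, HardSphere.mem_window]; exact this)
    · intro h
      refine h.of_subset fun x hx => ?_
      simp only [SetLike.mem_coe, glue, PointConfig.mem_union, mem_restrict_iff, mem_compl_iff] at hx ⊢
      rcases hx with hx | hx
      · exact Or.inl hx
      · exact Or.inr ⟨hx.1.1, hx.2⟩
  have hset : ∀ C : Set (PointConfig Phase),
      glue Λ (ζ.restrict W) ⁻¹' (PointConfig.restrict W ⁻¹' C ∩ hardCoreSet σ) =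
        glue Λ ζ ⁻¹' (PointConfig.restrict W ⁻¹' C ∩ hardCoreSet σ) := by
    intro C
    ext ξ
    simp only [mem_preimage, mem_inter_iff, HardSphere.mem_hardCoreSet, restrict_glue_restrict, hHC]
  have hsetH : glue Λ (ζ.restrict W) ⁻¹' hardCoreSet σ = glue Λ ζ ⁻¹' hardCoreSet σ := by
    ext ξ
    simp only [mem_preimage, HardSphere.mem_hardCoreSet, hHC]
  rw [hsLocalSpec_apply_eq ν σ hΛ _ hB, hsLocalSpec_apply_eq ν σ hΛ _ hB, hset, hsetH]

end Locality

/-! ### The limit marginals -/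

section Marginals

variable (ν : Measure Phase) [IsLocallyFiniteMeasure ν] {σ : ℝ}

/-- **The local limits of the free finite-volume distributions.**  At small activity
(`2κ < 1`), for every `k` the laws of the configuration in `B(0,k) × ℝ³` under the free
hard-sphere distributions `γ_{B(0,n)}(· | ∅)` converge setwise (uniformly) as `n → ∞` — they are
uniformly Cauchy by consistency and the decay of the boundary influence — and the limits `π_k`
are probability measures which are CONSISTENT (`π_{k+1} ∘ (·|_{B(0,k)})⁻¹ = π_k`), DOMINATED by
`e^{ν(B(0,k) × ℝ³)}` times the reference law of the window, carried by hard-core configurations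
inside the window, and satisfy the finite-window DLR identities
`∫ γ_Λ(ξ'|_{B(0,k)} ∈ A' | ξ) π_k(dξ) = π_k(A')` for every region `Λ` whose `σ`-neighbourhood
lies in `B(0,k)` (limits of the consistency identities, the integrand being local in the boundary
condition and the convergence setwise uniform). [cite: Georgii2011, Def. 1.23] -/
theorem exists_limit_marginals (hσ : 0 < σ) (h0 : ∀ x, ν {x} = 0)
    (hm : ∀ t : ℝ, ν {y : Phase | y.1 0 = t} = 0) {κ : ℝ} (hκ0 : 0 ≤ κ)
    (hκ : ∀ a : Pos, ν (window (Metric.ball a σ)) ≤ ENNReal.ofReal κ) (hκ1 : 2 * κ < 1)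
    (hfin : ∀ R : ℝ, ν (window (Metric.ball (0 : Pos) R)) ≠ ∞) :
    ∃ π : ℕ → Measure (PointConfig Phase),
      (∀ k, IsProbabilityMeasure (π k)) ∧
      (∀ (k : ℕ) (A' : Set (PointConfig Phase)), MeasurableSet A' →
        π (k + 1) (PointConfig.restrict (window (Metric.ball (0 : Pos) k)) ⁻¹' A') = π k A') ∧
      (∀ (k : ℕ) (A' : Set (PointConfig Phase)), MeasurableSet A' →
        π k A' ≤ ENNReal.ofReal (Real.exp (ν (window (Metric.ball (0 : Pos) k))).toReal) *
          poissonLaw (ν.restrict (window (Metric.ball (0 : Pos) k))) A') ∧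
      (∀ k, ∀ᵐ ξ ∂π k, IsHardCore σ ξ) ∧
      (∀ k : ℕ, ∀ᵐ ξ ∂π k, ξ.restrict (window (Metric.ball (0 : Pos) k)) = ξ) ∧
      (∀ (k : ℕ) (Λ : Set Pos), MeasurableSet Λ →
        (∀ q ∈ Λ, ∀ p : Pos, dist p q < σ → p ∈ Metric.ball (0 : Pos) k) →
        ∀ A' : Set (PointConfig Phase), MeasurableSet A' →
          ∫⁻ ω, hsLocalSpec σ ν Λ ω (PointConfig.restrict (window (Metric.ball (0 : Pos) k)) ⁻¹' A')
            ∂π k = π k A') := by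
  classical
  -- notation
  set W : ℕ → Set Phase := fun k => window (Metric.ball (0 : Pos) k) with hWdef
  set Q : ℕ → Measure (PointConfig Phase) := fun n => hsLocalSpec σ ν (Metric.ball 0 n) ∅ with hQdef
  have hWm : ∀ k, MeasurableSet (W k) := fun k =>
    HardSphere.measurableSet_window Metric.isOpen_ball.measurableSet
  have hrm : ∀ k, Measurable (PointConfig.restrict (W k) : PointConfig Phase → PointConfig Phase) :=
    fun k => PointConfig.measurable_restrict (hWm k)
  have hQprob : ∀ n, IsProbabilityMeasure (Q n) := fun n =>
    isProbabilityMeasure_hsLocalSpec ν h0 Metric.isOpen_ball.measurableSet (hfin n)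
      ((HardSphere.isHardCore_empty σ).restrict _)
  have hQHC : ∀ n, ∀ᵐ ζ ∂Q n, IsHardCore σ ζ := fun n => hsLocalSpec_ae_isHardCore ν σ _ ∅
  set C : ℕ → ℝ := fun k => 2 * ν.real (W k) * Real.exp (ν.real (W k)) with hCdef
  -- the mixture bound: for `n ≥ k + (d+2)σ`, `Q n` is within `C k (2κ)^d` of `γ_{B(0,k+(d+2)σ)}(∅)`
  have hmix : ∀ (k d : ℕ) (n : ℕ), (k : ℝ) + (d + 2) * σ ≤ n → ∀ A' : Set (PointConfig Phase),
      MeasurableSet A' →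
      |(Q n).real (PointConfig.restrict (W k) ⁻¹' A') -
        (hsLocalSpec σ ν (Metric.ball 0 (k + (d + 2) * σ)) ∅
          (PointConfig.restrict (W k) ⁻¹' A')).toReal| ≤ C k * (2 * κ) ^ d := by
    intro k d n hn A' hA'
    haveI := hQprob n
    exact abs_measureReal_sub_hsLocalSpec_empty_le_of_mixture ν hσ h0 hm hκ0 hκ hfin (hQHC n) k d hA'
      (lintegral_hsLocalSpec_ball_hsLocalSpec_ball_empty ν h0 hn (hA'.preimage (hrm k)))
  -- uniform Cauchy property of the `k`-marginals
  have hcauchy : ∀ k : ℕ, ∀ ε > 0, ∃ N : ℕ, ∀ n ≥ N, ∀ n' ≥ N, ∀ A : Set (PointConfig Phase),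
      MeasurableSet A → |((Q n).map (PointConfig.restrict (W k))).real A -
        ((Q n').map (PointConfig.restrict (W k))).real A| ≤ ε := by
    intro k ε hε
    have htend : Tendsto (fun d : ℕ => 2 * C k * (2 * κ) ^ d) atTop (𝓝 0) := by
      have h := (tendsto_pow_atTop_nhds_zero_of_lt_one (by positivity : 0 ≤ 2 * κ) hκ1).const_mul
        (2 * C k)
      rwa [mul_zero] at h
    obtain ⟨d, hd⟩ := (Metric.tendsto_atTop.1 htend) ε hε
    have hd' : 2 * C k * (2 * κ) ^ d ≤ ε := by
      have := hd d le_rfl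
      rw [Real.dist_eq, sub_zero, abs_of_nonneg (by positivity)] at this
      exact this.le
    refine ⟨⌈(k : ℝ) + (d + 2) * σ⌉₊, fun n hn n' hn' A hA => ?_⟩
    have hnR : (k : ℝ) + (d + 2) * σ ≤ n := (Nat.ceil_le).1 hn
    have hn'R : (k : ℝ) + (d + 2) * σ ≤ n' := (Nat.ceil_le).1 hn'
    rw [map_measureReal_apply (hrm k) hA, map_measureReal_apply (hrm k) hA]
    have h1 := hmix k d n hnR A hA
    have h2 := hmix k d n' hn'R A hA
    rw [abs_sub_comm] at h2
    calc _ ≤ _ := abs_sub_le _ _ _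
      _ ≤ C k * (2 * κ) ^ d + C k * (2 * κ) ^ d := add_le_add h1 h2
      _ = 2 * C k * (2 * κ) ^ d := by ring
      _ ≤ ε := hd'
  -- the limits
  have hlimit : ∀ k : ℕ, ∃ P : Measure (PointConfig Phase), IsProbabilityMeasure P ∧
      ∀ ε > 0, ∃ N : ℕ, ∀ n ≥ N, ∀ A : Set (PointConfig Phase), MeasurableSet A →
        |((Q n).map (PointConfig.restrict (W k))).real A - P.real A| ≤ ε := by
    intro k
    haveI : ∀ n, IsProbabilityMeasure ((Q n).map (PointConfig.restrict (W k))) := fun n => by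
      haveI := hQprob n; exact Measure.isProbabilityMeasure_map (hrm k).aemeasurable
    exact exists_measure_of_uniformly_cauchy _ (hcauchy k)
  choose π hπprob hπclose using hlimit
  have hconv : ∀ (k : ℕ) {A : Set (PointConfig Phase)}, MeasurableSet A →
      Tendsto (fun n => (Q n).real (PointConfig.restrict (W k) ⁻¹' A)) atTop (𝓝 ((π k).real A)) := by
    intro k A hA
    rw [Metric.tendsto_atTop]
    intro ε hε
    obtain ⟨N, hN⟩ := hπclose k (ε / 2) (half_pos hε)
    refine ⟨N, fun n hn => ?_⟩
    have := hN n hn A hA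
    rw [map_measureReal_apply (hrm k) hA] at this
    rw [Real.dist_eq]
    linarith
  refine ⟨π, hπprob, ?_, ?_, ?_, ?_, ?_⟩
  · -- consistency
    intro k A' hA'
    haveI := hπprob k
    haveI := hπprob (k + 1)
    have h1 := hconv (k + 1) (hA'.preimage (hrm k))
    have h2 := hconv k hA'
    have heq : (fun n => (Q n).real (PointConfig.restrict (W (k + 1)) ⁻¹'
        (PointConfig.restrict (W k) ⁻¹' A'))) =
        fun n => (Q n).real (PointConfig.restrict (W k) ⁻¹' A') := by
      funext n
      rw [← preimage_restrict_eq_preimage_restrict_of_le (by push_cast; linarith)]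
    rw [heq] at h1
    have := tendsto_nhds_unique h1 h2
    rw [measureReal_def, measureReal_def] at this
    exact (ENNReal.toReal_eq_toReal_iff' (measure_ne_top _ _) (measure_ne_top _ _)).1 this
  · -- domination
    intro k A' hA'
    haveI := hπprob k
    haveI := isProbabilityMeasure_poissonLaw (ν.restrict (W k))
    set D : ℝ≥0∞ := ENNReal.ofReal (Real.exp (ν (W k)).toReal) * poissonLaw (ν.restrict (W k)) A'
      with hD
    have hDtop : D ≠ ∞ := ENNReal.mul_ne_top ENNReal.ofReal_ne_top (measure_ne_top _ _)
    have hev : ∀ᶠ n : ℕ in atTop, (Q n).real (PointConfig.restrict (W k) ⁻¹' A') ≤ D.toReal := by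
      refine eventually_atTop.2 ⟨k, fun n hn => ?_⟩
      exact ENNReal.toReal_mono hDtop (hsLocalSpec_preimage_restrict_le ν h0
        Metric.isOpen_ball.measurableSet Metric.isOpen_ball.measurableSet
        (Metric.ball_subset_ball (Nat.cast_le.2 hn)) (hfin n)
        ((HardSphere.isHardCore_empty σ).restrict _) hA')
    have hle : (π k).real A' ≤ D.toReal := le_of_tendsto (hconv k hA') hev
    calc π k A' = ENNReal.ofReal ((π k).real A') := (ENNReal.ofReal_toReal (measure_ne_top _ _)).symm
      _ ≤ ENNReal.ofReal D.toReal := ENNReal.ofReal_le_ofReal hle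
      _ = D := ENNReal.ofReal_toReal hDtop
  · -- hard core
    intro k
    haveI := hπprob k
    have hH := HardSphere.measurableSet_hardCoreSet σ
    have hzero : ∀ n, (Q n).real (PointConfig.restrict (W k) ⁻¹' (hardCoreSet σ)ᶜ) = 0 := by
      intro n
      rw [measureReal_eq_zero_iff]
      have hsub : PointConfig.restrict (W k) ⁻¹' (hardCoreSet σ)ᶜ ⊆ (hardCoreSet σ)ᶜ :=
        fun ζ hζ hζ' => hζ (HardSphere.IsHardCore.restrict hζ' _)
      exact measure_mono_null hsub (hsLocalSpec_apply_compl_hardCoreSet σ ν _ ∅)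
    have h1 := hconv k hH.compl
    simp_rw [hzero] at h1
    have h2 : (π k).real (hardCoreSet σ)ᶜ = 0 := tendsto_nhds_unique h1 tendsto_const_nhds
    rw [ae_iff]
    exact (measureReal_eq_zero_iff (measure_ne_top _ _)).1 h2
  · -- carried by the window
    intro k
    haveI := hπprob k
    have hE := measurableSet_restrict_eq_self (hWm k) (s := W k)
    have hzero : ∀ n, (Q n).real (PointConfig.restrict (W k) ⁻¹'
        {ξ : PointConfig Phase | ξ.restrict (W k) = ξ}ᶜ) = 0 := by
      intro n
      have : PointConfig.restrict (W k) ⁻¹' {ξ : PointConfig Phase | ξ.restrict (W k) = ξ}ᶜ = ∅ :=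
        eq_empty_of_forall_notMem fun ζ hζ => hζ (restrict_restrict_of_subset subset_rfl ζ)
      rw [this, measureReal_def, measure_empty, ENNReal.toReal_zero]
    have h1 := hconv k hE.compl
    simp_rw [hzero] at h1
    have h2 : (π k).real {ξ : PointConfig Phase | ξ.restrict (W k) = ξ}ᶜ = 0 :=
      tendsto_nhds_unique h1 tendsto_const_nhds
    rw [ae_iff]
    exact (measureReal_eq_zero_iff (measure_ne_top _ _)).1 h2
  · -- the finite-window DLR identities
    intro k Λ hΛ hΛσ A' hA'
    haveI := hπprob k
    have hΛk : Λ ⊆ Metric.ball (0 : Pos) k := fun q hq => hΛσ q hq q (by rw [dist_self]; exact hσ)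
    set B : Set (PointConfig Phase) := PointConfig.restrict (W k) ⁻¹' A' with hBdef
    have hBm : MeasurableSet B := hA'.preimage (hrm k)
    set Ψ : PointConfig Phase → ℝ≥0∞ := fun ω => hsLocalSpec σ ν Λ ω B with hΨdef
    have hΨm : Measurable Ψ := measurable_hsLocalSpec_apply ν σ hΛ hBm
    have hΨle : ∀ ω, Ψ ω ≤ 1 := fun ω => hsLocalSpec_apply_le_one ν σ Λ ω B
    have hΨeq : ∀ ω, Ψ ω = ENNReal.ofReal (Ψ ω).toReal := fun ω =>
      (ENNReal.ofReal_toReal (ne_top_of_le_ne_top ENNReal.one_ne_top (hΨle ω))).symm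
    -- the identity at finite `n`
    have hfinite : ∀ n : ℕ, k ≤ n →
        ∫⁻ ω, Ψ ω ∂((Q n).map (PointConfig.restrict (W k))) = (Q n) B := by
      intro n hn
      rw [lintegral_map hΨm (hrm k)]
      have : ∫⁻ ζ, Ψ (PointConfig.restrict (W k) ζ) ∂Q n = ∫⁻ ζ, hsLocalSpec σ ν Λ ζ B ∂Q n := by
        refine lintegral_congr_ae ((hQHC n).mono fun ζ hζ => ?_)
        exact hsLocalSpec_restrict_boundary_apply ν hΛ hΛσ hζ hA'
      rw [this]
      exact lintegral_hsLocalSpec_hsLocalSpec_empty ν h0 hΛ Metric.isOpen_ball.measurableSet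
        (hΛk.trans (Metric.ball_subset_ball (Nat.cast_le.2 hn))) hBm
    -- pass to the limit
    have hlim1 : Tendsto (fun n : ℕ => (∫⁻ ω, Ψ ω ∂((Q n).map (PointConfig.restrict (W k)))).toReal)
        atTop (𝓝 ((π k).real A')) := by
      refine (hconv k hA').congr' (eventually_atTop.2 ⟨k, fun n hn => ?_⟩)
      change (Q n).real B = (∫⁻ ω, Ψ ω ∂((Q n).map (PointConfig.restrict (W k)))).toReal
      rw [hfinite n hn, measureReal_def]
    have hlim2 : Tendsto (fun n : ℕ => (∫⁻ ω, Ψ ω ∂((Q n).map (PointConfig.restrict (W k)))).toReal)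
        atTop (𝓝 ((∫⁻ ω, Ψ ω ∂π k).toReal)) := by
      rw [Metric.tendsto_atTop]
      intro ε hε
      obtain ⟨N, hN⟩ := hπclose k (ε / 2) (half_pos hε)
      refine ⟨N, fun n hn => ?_⟩
      haveI : IsProbabilityMeasure ((Q n).map (PointConfig.restrict (W k))) := by
        haveI := hQprob n; exact Measure.isProbabilityMeasure_map (hrm k).aemeasurable
      have h := abs_lintegral_toReal_sub_le_of_abs_measureReal_sub_le (hN n hn)
        hΨm.ennreal_toReal (fun ω => ENNReal.toReal_nonneg)
        (fun ω => ENNReal.toReal_le_of_le_ofReal zero_le_one (by rw [ENNReal.ofReal_one]; exact hΨle ω))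
      simp_rw [← hΨeq] at h
      rw [Real.dist_eq]
      linarith
    have heq := tendsto_nhds_unique hlim2 hlim1
    rw [measureReal_def] at heq
    exact (ENNReal.toReal_eq_toReal_iff' (ne_top_of_le_ne_top (measure_ne_top (π k) univ)
      ((lintegral_mono fun ω => hΨle ω).trans_eq lintegral_one)) (measure_ne_top _ _)).1 heq

end Marginals

end Literature.MathematicalPhysics.KineticTheory

end
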